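import Literature.NumberTheory.Rogawski1990.UnitFundamentalLemmaInertResiduallyRegularExplicit
import HarnessLib

/-!
# The one-place model of `G′_v = U(H′)(L⁺_v)` at a good non-split place, in the coordinates of Flicker's count:
# `G = U(2,1)(E_w) ≤ GL₃(E_w)`, `K = GL₃(𝒪_w) ∩ G`, `H = Z_G(diag(1,−1,1)) = ι(U(1,1) × U(1))`, matching = conjugacy in `GL₃(E_w)`
# (Flicker 1998 §2 pp. 77–79; Rogawski 1990 §14.2 p. 233, §4.9 p. 54)

Topic `NumberTheory/Rogawski1990`; namespace `Literature.NumberTheory.Rogawski1990`.  **Theorems only** (no `def`, no instance, no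
notation, no named fact, no `sorry`); imports = tree.  Brick (F0) «ONE-PLACE MODEL» of the road «N7-ns COUNT FROM FLICKER» (the in-house
proof of the unit fundamental lemma at the non-split places, [Flicker1998UnitaryFL]); by the architect's ruling the road is typed
`Φ₃`-NATIVELY: the group of record is the tree's quasi-split `U(σ_w, Φ₃)(L_w)`, `Φ₃ = antidiag(1,1,1)` (★ `localNonsplitEquiv`), and Flicker's
`J = antidiag(1,−1,1)` enters only through the recorded identity `D Φ₃ D = −J`, `U(−J) = U(J)` (§1).

**Setting.** `L` a CM field, `c` = complex conjugation, `L⁺` its maximal totally real subfield; `H′ ∈ M₃(L)` hermitian; `v` a finite place of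
`L⁺` NON-SPLIT in `L` (`w ∣ v`, `c • w = w`, so `L ⊗ L⁺_v = L_w`, `σ_w = galAdicCompletionMap c hw`), unramified, of good reduction for `H′`
(`H′_w ∈ GL₃(𝒪_w)`).  `G′_v = (cmDatum L 3 H′).Local v = U(H′)(L⁺_v)`, `K′ = cmLocalIntegralLevel = U(H′)(𝒪_v)`; the endoscopic side
`H_v = U(Φ₂)(L⁺_v) × U(Φ₁)(L⁺_v)` with `ι_v = endoEmbLocal` (★ `EndoscopicEmbedding`), and the matching relation ★ `IsLocalNormPair L H′ v γ_H γ′`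
(`ι_v(γ_H)` and `γ′` conjugate in `GL₃(∏_{w′∣v} L_{w′})`, [Rogawski1990 §3.1, §4.9]).

**Contents.**
* §1 (any commutative ring, `2` invertible where needed) — Flicker's matrices as literals: `h = (1 0 1; 0 1 0; −1 0 1)` and `h⁻¹` (Prop. 3 p. 78),
  `t₁ = h⁻¹ diag(a,b,c) h = (½(a+c) 0 ½(a−c); 0 b 0; ½(a−c) 0 ½(a+c))` (p. 79: the `U(1)`-eigenvalue `b` on the middle line, `a, c` on the
  `U(1,1)`-plane `⟨e₁,e₃⟩`), the identities `ᵗσ(D) Φ₃ D = −J` for `D = diag(1,1,−1)` and `= J` for `D = diag(1,d,1)`, `σ(d) d = −1`,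
  `U(−J) = U(J)`, and `diag(1,d,1) · ι(g,u) = ι(g,u) · diag(1,d,1)` (the twist fixes the `H`-pattern `(a 0 b; 0 u 0; c 0 d′)` = ★ `coe_endoGL_eq`).
* §2 THE FRAME at a good non-split place: `isUnit_two_integer_iff_valued_eq_one` (the road's «`p ≠ 2`» binder `IsUnit (2 : 𝒪[L_w])` ↔
  `|2|_w = 1`); `coe_localNonsplitEquiv_endoEmbLocal` (`ι_v(γ_H)_w = ι((γ_H.1)_w, (γ_H.2)_w)` — Flicker's `H = Z_G(diag(1,−1,1))` IS the tree's
  pattern); `isLocalNormPair_iff_isConj_endoGL_conj` (matching ⟺ conjugacy of `ι((γ_H)_w)` and `T γ′_w T⁻¹` in `GL₃(L_w)`, any `T`);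
  `mem_cmLocalIntegralLevel_iff_conj_mem_glInt` (`γ′ ∈ K′ ⟺ T γ′_w T⁻¹ ∈ GL₃(𝒪_w)` for `T ∈ GL₃(𝒪_w)`); and the package
  **`exists_frame_of_nonsplit`**: an integral hyperbolic basis `T ∈ GL₃(𝒪_w)` of `H′_w` (★ integral Jacobowitz
  `exists_glInt_placeForm_eq_formCongr_antidiagonal_of_isUnramifiedIn`) and `e : G′_v ≃ₜ* U(σ_w, Φ₃)(L_w)`, `e γ′ = T γ′_w T⁻¹`
  (★ `localNonsplitCongr`, the level-preserving `ψ` of [Rogawski1990 §14.2 p. 233] «`K_v ≃ K′_v`», then ★ `localNonsplitEquiv`), with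
  `e(K′) = K` and matching = conjugacy with `ι((γ_H)_w)`.  Downstream bricks (double cosets `H∖G∕K`, unfolding, congruence volumes) are stated
  INSIDE `U(σ_w, Φ₃)(L_w) ≤ GL₃(L_w)` and meet `G′_v` only through `e`.

What is NOT here (brick (F0) part 2): the type-(1) dictionary `γ_H = (g,u) ↦ t₀ = (a,b,c)`, `(N₁,N₂,N) = (n₁₂,n₂₃,n₁₃)`, Flicker's
representatives `t₁,…,t₄` against the four classes of ★ `LocalStableClassesNonsplitKappaCount` (`κ = (+,+,−,−)`), and the normalisation of the
canonical orbital integrals (`vol K = 1`, torus mass `1`).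

Kernel note: the composite `e` is unfolded by the LEMMA `ContinuousMulEquiv.trans_apply`, never by δ-reduction of ★ `localNonsplitCongr`
(which costs the kernel > 60 s); the domain of `e` is spelled `↥(UnitaryGroup.«local» L c 3 H′ v)`, the carrier of `(cmDatum L 3 H′).Local v`
(★ `cmDatum_Local`, `rfl`).

## References
* Y. Z. Flicker, *Elementary proof of the fundamental lemma for a unitary group*, Canad. J. Math. 50 (1998) 74–98, §1 p. 74 (`p > 2`), §2
  pp. 77–79 (the model `U(J)`, `J = antidiag(1,−1,1)`; Prop. 3: `T₀`, `h`, `r`, `t₁,…,t₄`, `H = Z_G(diag(1,−1,1)) = U(1,1) × U(1)`)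
  [Flicker1998UnitaryFL].
* J. Rogawski, *Automorphic Representations of Unitary Groups in Three Variables*, Ann. of Math. Stud. 123 (1990), §14.2 p. 233 («`K_v ≃ K′_v`»),
  §4.8 Case (a) p. 53, §4.9 p. 54, §3.1 p. 19 [Rogawski1990].
* R. Jacobowitz, *Hermitian forms over local fields*, Amer. J. Math. 84 (1962), §7 Thm. 7.1 [Jacobowitz1962].
* V. Platonov, A. Rapinchuk, *Algebraic Groups and Number Theory* (1994), §2.3, §5.1 [PlatonovRapinchuk1994].
* J. W. S. Cassels, A. Fröhlich (eds.), *Algebraic Number Theory* (1967), Ch. II §10 [CasselsFrohlichANT1967].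
-/

set_option autoImplicit false

noncomputable section

open NumberField IsDedekindDomain Matrix
open Literature.NumberTheory.Automorphic Literature.NumberTheory.Automorphic.UnitaryGroup
open Literature.NumberTheory.Automorphic.IntegralReduction Literature.NumberTheory.GaloisRepresentations
open scoped MatrixGroups ValuativeRel

namespace Literature.NumberTheory.Rogawski1990

/-! ## §1 Flicker's matrices (any commutative ring with `2` invertible): `h`, `h⁻¹`, `t₁ = h⁻¹ diag(a,b,c) h`, `J = ᵗσ(D) Φ₃ D` -/

section Generic

variable {R : Type*} [CommRing R]

/-- **`h · h⁻¹ = 1`** for Flicker's `h = (1 0 1; 0 1 0; −1 0 1)` and `h⁻¹ = ½ (1 0 −1; 0 2 0; 1 0 1)` (`2` invertible).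
[cite: Flicker1998UnitaryFL, §2 Prop. 3 p. 78] -/
theorem flickerH_mul_flickerHInv [Invertible (2 : R)] :
    !![(1 : R), 0, 1; 0, 1, 0; -1, 0, 1] * !![⅟(2 : R), 0, -⅟(2 : R); 0, 1, 0; ⅟(2 : R), 0, ⅟(2 : R)] = 1 := by
  have h2 : ⅟(2 : R) + ⅟(2 : R) = 1 := by rw [← two_mul, mul_invOf_self]
  ext i j
  fin_cases i <;> fin_cases j <;> simp [Matrix.mul_apply, Fin.sum_univ_three, h2]

/-- **`h⁻¹ · h = 1`**. [cite: Flicker1998UnitaryFL, §2 Prop. 3 p. 78] -/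
theorem flickerHInv_mul_flickerH [Invertible (2 : R)] :
    !![⅟(2 : R), 0, -⅟(2 : R); 0, 1, 0; ⅟(2 : R), 0, ⅟(2 : R)] * !![(1 : R), 0, 1; 0, 1, 0; -1, 0, 1] = 1 := by
  have h2 : ⅟(2 : R) + ⅟(2 : R) = 1 := by rw [← two_mul, mul_invOf_self]
  ext i j
  fin_cases i <;> fin_cases j <;> simp [Matrix.mul_apply, Fin.sum_univ_three, h2]

/-- **`t₁ = h⁻¹ · diag(a, b, c) · h = (½(a+c) 0 ½(a−c); 0 b 0; ½(a−c) 0 ½(a+c))`** — Flicker's representative of the elliptic torus `T₁ = h⁻¹ T₀ h`,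
`T₀` the diagonal torus; the `U(1)`-eigenvalue `b` sits on the MIDDLE line `e₂`, the eigenvalues `a, c` on the plane `⟨e₁, e₃⟩` = the `U(1,1)`-block of
`H = Z_G(diag(1,−1,1))`. [cite: Flicker1998UnitaryFL, §2 Prop. 3 pp. 78–79] -/
theorem flickerHInv_mul_diagonal_mul_flickerH [Invertible (2 : R)] (a b c : R) :
    !![⅟(2 : R), 0, -⅟(2 : R); 0, 1, 0; ⅟(2 : R), 0, ⅟(2 : R)] * !![a, 0, 0; 0, b, 0; 0, 0, c] * !![(1 : R), 0, 1; 0, 1, 0; -1, 0, 1] =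
      !![⅟(2 : R) * (a + c), 0, ⅟(2 : R) * (a - c); 0, b, 0; ⅟(2 : R) * (a - c), 0, ⅟(2 : R) * (a + c)] := by
  ext i j
  fin_cases i <;> fin_cases j <;> simp [Matrix.mul_apply, Fin.sum_univ_three] <;> ring

/-- **Flicker's `J = antidiag(1, −1, 1)` is the tree's split form `Φ₃ = antidiag(1, 1, 1)` twisted by `D = diag(1, d, 1)` with `σ(d) d = −1`**:
`ᵗσ(D) · Φ₃ · D = J` (★ `formCongr`).  At a non-split unramified place `d` may be taken a UNIT (`−1 = N(d)`, ★ `exists_mul_map_eq_of_finite_residueField`).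
[cite: Flicker1998UnitaryFL, §2 p. 77] [cite: PlatonovRapinchuk1994, §2.3] -/
theorem formCongr_antidiagOne_eq_flickerJ (σ : R →+* R) {d : R} (hd : σ d * d = -1) (D : GL (Fin 3) R) (hD : D.val = diagonal ![1, d, 1]) :
    formCongr σ D (Matrix.of fun i j : Fin 3 => if i.val + j.val + 1 = 3 then (1 : R) else 0) = !![(0 : R), 0, 1; 0, -1, 0; 1, 0, 0] := by
  rw [formCongr, hD]
  ext i j
  fin_cases i <;> fin_cases j <;> simp [Matrix.mul_apply, Fin.sum_univ_three, diagonal, Matrix.of_apply, hd]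

/-- **The architect's record of Flicker's form (A-p06 (g26)): `D · Φ₃ · D = −J` for the SIGN matrix `D = diag(1, 1, −1)`** (`σ` fixes `±1`), so that
`U(Φ₃) = D · U(−J) · D = D · U(J) · D` (`U(−J) = U(J)`, `unitaryGroupOfForm_neg`): the road «N7-ns COUNT FROM FLICKER» is typed `Φ₃`-NATIVELY and Flicker's
`J = antidiag(1, −1, 1)` enters only through this identity. [cite: Flicker1998UnitaryFL, §2 p. 77] [cite: PlatonovRapinchuk1994, §2.3] -/
theorem formCongr_signDiagonal_antidiagOne_eq_neg_flickerJ (σ : R →+* R) (D : GL (Fin 3) R) (hD : D.val = diagonal ![1, 1, -1]) :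
    formCongr σ D (Matrix.of fun i j : Fin 3 => if i.val + j.val + 1 = 3 then (1 : R) else 0) = -!![(0 : R), 0, 1; 0, -1, 0; 1, 0, 0] := by
  rw [formCongr, hD]
  ext i j
  fin_cases i <;> fin_cases j <;> simp [Matrix.mul_apply, Fin.sum_univ_three, diagonal, Matrix.of_apply]

/-- **`U(σ, −J) = U(σ, J)`** (the defining relation `ᵗσ(g) J g = J` is linear in `J`). [cite: PlatonovRapinchuk1994, §2.3] -/
theorem unitaryGroupOfForm_neg {n : Type*} [Fintype n] [DecidableEq n] (σ : R →+* R) (J : Matrix n n R) :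
    unitaryGroupOfForm σ (-J) = unitaryGroupOfForm σ J := by
  ext g
  rw [mem_unitaryGroupOfForm_iff, mem_unitaryGroupOfForm_iff, Matrix.mul_neg, Matrix.neg_mul, neg_inj]

/-- **`D = diag(1, d, 1)` commutes with the pattern `ι(g, u) = (a 0 b; 0 u 0; c 0 d′)`** — so the `D`-twist `U(Φ₃) → U(J)` fixes the endoscopic
subgroup `ι(U(1,1) × U(1)) = Z(diag(1,−1,1))` pointwise. [cite: Flicker1998UnitaryFL, §2 Prop. 3 p. 78] [cite: Rogawski1990, §4.8 Case (a) p. 53] -/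
theorem diagonal_mul_endoGL_eq (d : R) (g : GL (Fin 2) R × GL (Fin 1) R) :
    diagonal ![1, d, 1] * ((endoGL g : GL (Fin 3) R) : Matrix (Fin 3) (Fin 3) R) =
      ((endoGL g : GL (Fin 3) R) : Matrix (Fin 3) (Fin 3) R) * diagonal ![1, d, 1] := by
  rw [coe_endoGL_eq]
  ext i j
  fin_cases i <;> fin_cases j <;> simp [Matrix.mul_apply, diagonal, mul_comm]

/-- `IsConj` is invariant under a multiplicative equivalence. [folklore] -/
private theorem isConj_map_iff {G G' : Type*} [Monoid G] [Monoid G'] (e : G ≃* G') {a b : G} :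
    IsConj (e a) (e b) ↔ IsConj a b := by
  refine ⟨fun h => ?_, fun h => MonoidHom.map_isConj e.toMonoidHom h⟩
  have h' := MonoidHom.map_isConj e.symm.toMonoidHom h
  simpa using h'

/-- In a group, `IsConj x y ↔ IsConj x (T y T⁻¹)`. [folklore] -/
private theorem isConj_conj_iff {G : Type*} [Group G] (x y T : G) : IsConj x (T * y * T⁻¹) ↔ IsConj x y :=
  ⟨fun h => h.trans (isConj_iff.2 ⟨T⁻¹, by group⟩), fun h => h.trans (isConj_iff.2 ⟨T, rfl⟩)⟩

end Generic

/-! ## §2 The frame at a good non-split place: `G′_v ≃ₜ* U(σ_w, Φ₃)(L_w) ≤ GL₃(L_w)` carrying `K′` onto `GL₃(𝒪_w) ∩ U`, `ι_v` onto `ι`, matches onto conjugacy -/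

section Frame

variable (L : Type) [Field L] [NumberField L] [IsCMField L] (H' : Matrix (Fin 3) (Fin 3) L)
  {v : HeightOneSpectrum (𝓞 ↥(maximalRealSubfield L))}

omit [IsCMField L] in
/-- **Flicker's standing «`p > 2`» in the tree's two spellings**: `2 ∈ 𝒪_w^×` iff `|2|_w = 1` (the road's binder at `K = L_w` is `IsUnit (2 : 𝒪[L_w])`; generic
valued-field files carry `Valued.v 2 = 1`).  Places of residue characteristic `2` are finitely many and sit in the letter's `Sbad`. [cite: Flicker1998UnitaryFL, §1 p. 74]
[cite: CasselsFrohlichANT1967, Ch. II §10] -/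
theorem isUnit_two_integer_iff_valued_eq_one (w : HeightOneSpectrum (𝓞 L)) :
    IsUnit (2 : 𝒪[w.adicCompletion L]) ↔ Valued.v (2 : w.adicCompletion L) = 1 := by
  rw [Valuation.Integers.isUnit_iff_valuation_eq_one (Valuation.integer.integers (ValuativeRel.valuation (w.adicCompletion L))),
    (ValuativeRel.isEquiv (ValuativeRel.valuation (w.adicCompletion L)) (Valued.v : Valuation (w.adicCompletion L) _)).eq_one_iff_eq_one]
  rfl

/-- **`ι_v` IN THE ONE-PLACE MODEL IS FLICKER'S PATTERN**: the `w`-component of `ι_v(γ_H)` (★ `localNonsplitEquiv` for `Φ₃`) is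
`ι((γ_H.1)_w, (γ_H.2)_w) = (a 0 b; 0 u 0; c 0 d)` (★ `endoGL`, ★ `map_endoGL`) — the subgroup `H = Z_G(diag(1,−1,1)) = U(1,1) × U(1)` of [Flicker, Prop. 3].
[cite: Flicker1998UnitaryFL, §2 Prop. 3 p. 78] [cite: Rogawski1990, §4.8 Case (a) p. 53] [cite: PlatonovRapinchuk1994, §5.1] -/
theorem coe_localNonsplitEquiv_endoEmbLocal (w : PlacesOver L v) (hw : IsCMField.complexConj L • w.1 = w.1)
    (γH : (cmDatum L 2 (Matrix.of fun i j : Fin 2 => if i.val + j.val + 1 = 2 then (1 : L) else 0)).Local v ×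
      (cmDatum L 1 (Matrix.of fun i j : Fin 1 => if i.val + j.val + 1 = 1 then (1 : L) else 0)).Local v) :
    ((localNonsplitEquiv (IsCMField.complexConj L)
        (Matrix.of fun i j : Fin 3 => if i.val + j.val + 1 = 3 then (1 : L) else 0) (IsCMField.complexConj_ne_one L) w hw
        (endoEmbLocal L v γH) :
        unitaryGroupOfForm (galAdicCompletionMap (L := L) (IsCMField.complexConj L) hw)
          (placeForm (Matrix.of fun i j : Fin 3 => if i.val + j.val + 1 = 3 then (1 : L) else 0) w.1)) :
        GL (Fin 3) (w.1.adicCompletion L)) =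
      endoGL
        (((localNonsplitEquiv (IsCMField.complexConj L)
            (Matrix.of fun i j : Fin 2 => if i.val + j.val + 1 = 2 then (1 : L) else 0) (IsCMField.complexConj_ne_one L) w hw γH.1 :
            unitaryGroupOfForm (galAdicCompletionMap (L := L) (IsCMField.complexConj L) hw)
              (placeForm (Matrix.of fun i j : Fin 2 => if i.val + j.val + 1 = 2 then (1 : L) else 0) w.1)) :
            GL (Fin 2) (w.1.adicCompletion L)),
          ((localNonsplitEquiv (IsCMField.complexConj L)
            (Matrix.of fun i j : Fin 1 => if i.val + j.val + 1 = 1 then (1 : L) else 0) (IsCMField.complexConj_ne_one L) w hw γH.2 :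
            unitaryGroupOfForm (galAdicCompletionMap (L := L) (IsCMField.complexConj L) hw)
              (placeForm (Matrix.of fun i j : Fin 1 => if i.val + j.val + 1 = 1 then (1 : L) else 0) w.1)) :
            GL (Fin 1) (w.1.adicCompletion L))) := by
  have h := map_endoGL (Pi.evalRingHom (fun w' : PlacesOver L v => w'.1.adicCompletion L) w)
    ((γH.1.val : GL (Fin 2) (LocalRing L v)), (γH.2.val : GL (Fin 1) (LocalRing L v)))
  exact Units.ext (congrArg Units.val h)

/-- **MATCHING IS CONJUGACY IN THE ONE-PLACE MODEL**: at a non-split place, `ι_v(γ_H) ↔ γ′` (★ `IsLocalNormPair`: conjugacy in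
`GL₃(∏_{w′∣v} L_{w′})`) iff `ι((γ_H)_w)` and `T γ′_w T⁻¹` are conjugate in `GL₃(L_w)` — for ANY `T ∈ GL₃(L_w)` (the frame's change of basis).
[cite: Rogawski1990, §3.1 p. 19; §4.9 p. 54] [cite: PlatonovRapinchuk1994, §5.1] -/
theorem isLocalNormPair_iff_isConj_endoGL_conj (w : PlacesOver L v) (hw : IsCMField.complexConj L • w.1 = w.1)
    (T : GL (Fin 3) (w.1.adicCompletion L))
    (γH : (cmDatum L 2 (Matrix.of fun i j : Fin 2 => if i.val + j.val + 1 = 2 then (1 : L) else 0)).Local v ×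
      (cmDatum L 1 (Matrix.of fun i j : Fin 1 => if i.val + j.val + 1 = 1 then (1 : L) else 0)).Local v)
    (b : (cmDatum L 3 H').Local v) :
    IsLocalNormPair L H' v γH b ↔
      IsConj
          (endoGL
            (((localNonsplitEquiv (IsCMField.complexConj L)
                (Matrix.of fun i j : Fin 2 => if i.val + j.val + 1 = 2 then (1 : L) else 0) (IsCMField.complexConj_ne_one L) w hw γH.1).val :
                GL (Fin 2) (w.1.adicCompletion L)),
              ((localNonsplitEquiv (IsCMField.complexConj L)
                (Matrix.of fun i j : Fin 1 => if i.val + j.val + 1 = 1 then (1 : L) else 0) (IsCMField.complexConj_ne_one L) w hw γH.2).val :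
                GL (Fin 1) (w.1.adicCompletion L))))
          (T * ((localNonsplitEquiv (IsCMField.complexConj L) H' (IsCMField.complexConj_ne_one L) w hw b).val :
            GL (Fin 3) (w.1.adicCompletion L)) * T⁻¹) := by
  rw [isConj_conj_iff, ← coe_localNonsplitEquiv_endoEmbLocal L w hw γH]
  exact (isConj_map_iff ((localGLPiEquiv L 3 v).toMulEquiv.trans
    (localGLPiEvalEquiv (IsCMField.complexConj L) 3 (IsCMField.complexConj_ne_one L) w hw).toMulEquiv)).symm

/-- **LEVELS IN THE ONE-PLACE MODEL UNDER AN INTEGRAL CHANGE OF BASIS**: for `T ∈ GL₃(𝒪_w)`, `g ∈ K′ = U(H′)(𝒪_v)` iff `T g_w T⁻¹ ∈ GL₃(𝒪_w)`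
(★ `mem_localIntegralLevel_iff_of_smul_eq`). [cite: Rogawski1990, §14.2 p. 233; §4.9 p. 54] -/
theorem mem_cmLocalIntegralLevel_iff_conj_mem_glInt (w : PlacesOver L v) (hw : IsCMField.complexConj L • w.1 = w.1)
    {T : GL (Fin 3) (w.1.adicCompletion L)} (hT : T ∈ glInt 3 (w.1.adicCompletion L)) (g : (cmDatum L 3 H').Local v) :
    g ∈ cmLocalIntegralLevel L 3 H' v ↔
      T * ((localNonsplitEquiv (IsCMField.complexConj L) H' (IsCMField.complexConj_ne_one L) w hw g).val :
        GL (Fin 3) (w.1.adicCompletion L)) * T⁻¹ ∈ glInt 3 (w.1.adicCompletion L) := by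
  refine (mem_localIntegralLevel_iff_of_smul_eq (IsCMField.complexConj L) 3 H' (IsCMField.complexConj_ne_one L) w hw g).trans
    ⟨fun hg => Subgroup.mul_mem _ (Subgroup.mul_mem _ hT hg) (Subgroup.inv_mem _ hT), fun hg => ?_⟩
  have h1 := Subgroup.mul_mem _ (Subgroup.mul_mem _ (Subgroup.inv_mem _ hT) hg) hT
  rwa [show T⁻¹ * (T * ((localNonsplitEquiv (IsCMField.complexConj L) H' (IsCMField.complexConj_ne_one L) w hw g).val :
      GL (Fin 3) (w.1.adicCompletion L)) * T⁻¹) * T =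
    ((localNonsplitEquiv (IsCMField.complexConj L) H' (IsCMField.complexConj_ne_one L) w hw g).val : GL (Fin 3) (w.1.adicCompletion L)) by group] at h1

/-- **THE FRAME (type-free, `Φ₃`-native).**  At a finite place `v` of `L⁺` non-split (`c • w = w`) and unramified in `L`, of good reduction for the
hermitian `H′` (`H′_w ∈ GL₃(𝒪_w)`): there are an integral hyperbolic basis `T ∈ GL₃(𝒪_w)` of `H′_w` (★ Jacobowitz) and an isomorphism of topological
groups `e : G′_v = U(H′)(L⁺_v) ≃ₜ* U(σ_w, Φ₃)(L_w) ≤ GL₃(L_w)` (domain spelled `↥(UnitaryGroup.«local» L c 3 H′ v)`, the carrier of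
`(cmDatum L 3 H′).Local v` by ★ `cmDatum_Local` `rfl`, so that the kernel never compares bundled instances) — Flicker's `G = U(2,1)(E∕F)` in `GL(3, E)` at `E∕F := L_w∕L⁺_v` — such that
(i) `e g = T g_w T⁻¹` (★ `localNonsplitCongr` then ★ `localNonsplitEquiv`), (ii) `e(K′) = K := GL₃(𝒪_w) ∩ G` (`K′ = U(H′)(𝒪_v)`, ★ `cmLocalIntegralLevel`),
(iii) MATCHING IS CONJUGACY: `ι_v(γ_H) ↔ γ′` (★ `IsLocalNormPair`) iff `ι((γ_H)_w)` and `e γ′` are conjugate in `GL₃(L_w)`.  («`K_v ≃ K′_v`» of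
[Rogawski1990 §14.2 p. 233]; Flicker's standing model §2.) [cite: Flicker1998UnitaryFL, §2 pp. 77–79] [cite: Rogawski1990, §14.2 p. 233; §4.9 p. 54]
[cite: Jacobowitz1962, §7 Thm. 7.1] [cite: PlatonovRapinchuk1994, §5.1] -/
theorem exists_frame_of_nonsplit (hH' : (H'.map (IsCMField.complexConj L))ᵀ = H')
    (w : PlacesOver L v) (hw : IsCMField.complexConj L • w.1 = w.1) (hv : Algebra.IsUnramifiedIn (𝓞 L) v.asIdeal)
    (hH'w : IsUnit (placeForm H' w.1)) (hH'i : hH'w.unit ∈ glInt 3 (w.1.adicCompletion L)) :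
    ∃ (T : GL (Fin 3) (w.1.adicCompletion L))
      (e : ↥(UnitaryGroup.«local» L (IsCMField.complexConj L) 3 H' v) ≃ₜ*
        ↥(unitaryGroupOfForm (galAdicCompletionMap (L := L) (IsCMField.complexConj L) hw)
          (placeForm (Matrix.of fun i j : Fin 3 => if i.val + j.val + 1 = 3 then (1 : L) else 0) w.1))),
      T ∈ glInt 3 (w.1.adicCompletion L) ∧
      (∀ g, ((e g).val : GL (Fin 3) (w.1.adicCompletion L)) =
        T * ((localNonsplitEquiv (IsCMField.complexConj L) H' (IsCMField.complexConj_ne_one L) w hw g).val :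
          GL (Fin 3) (w.1.adicCompletion L)) * T⁻¹) ∧
      (∀ g, g ∈ cmLocalIntegralLevel L 3 H' v ↔ ((e g).val : GL (Fin 3) (w.1.adicCompletion L)) ∈ glInt 3 (w.1.adicCompletion L)) ∧
      (∀ γH b, IsLocalNormPair L H' v γH b ↔
        IsConj
          (endoGL
            (((localNonsplitEquiv (IsCMField.complexConj L)
                (Matrix.of fun i j : Fin 2 => if i.val + j.val + 1 = 2 then (1 : L) else 0) (IsCMField.complexConj_ne_one L) w hw γH.1).val :
                GL (Fin 2) (w.1.adicCompletion L)),
              ((localNonsplitEquiv (IsCMField.complexConj L)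
                (Matrix.of fun i j : Fin 1 => if i.val + j.val + 1 = 1 then (1 : L) else 0) (IsCMField.complexConj_ne_one L) w hw γH.2).val :
                GL (Fin 1) (w.1.adicCompletion L))))
          ((e b).val : GL (Fin 3) (w.1.adicCompletion L))) := by
  have hc := IsCMField.complexConj_ne_one L
  haveI : Algebra.IsQuadraticExtension ↥(maximalRealSubfield L) L := IsCMField.isQuadraticExtension L
  obtain ⟨T, hT, hJT⟩ := exists_glInt_placeForm_eq_formCongr_antidiagonal_of_isUnramifiedIn ↥(maximalRealSubfield L) L
    (IsCMField.complexConj L) hc 3 H' hH' v w hw hv hH'w hH'i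
  have h : formCongr (galAdicCompletionMap (L := L) (IsCMField.complexConj L) hw) T
      (placeForm (Matrix.of fun i j : Fin 3 => if i.val + j.val + 1 = 3 then (1 : L) else 0) w.1) =
        (1 : w.1.adicCompletion L) • placeForm H' w.1 := by
    rw [one_smul, placeForm_antidiagOne, ← hJT]
  -- `ψ : U(H′)(L⁺_v) ≃ₜ* U(Φ₃)(L⁺_v)`, `(ψ g)_w = T g_w T⁻¹`; the frame is `e := (one-place model of U(Φ₃)) ∘ ψ`
  set e := (localNonsplitCongr (IsCMField.complexConj L) hc w hw T isUnit_one h).trans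
    (localNonsplitEquiv (IsCMField.complexConj L) (Matrix.of fun i j : Fin 3 => if i.val + j.val + 1 = 3 then (1 : L) else 0) hc w hw)
    with he
  -- (the composite is unfolded by the LEMMA `trans_apply`, never by kernel δ-reduction of `localNonsplitCongr`: 20 ms vs > 60 s)
  have hform : ∀ g, ((e g).val : GL (Fin 3) (w.1.adicCompletion L)) =
      T * ((localNonsplitEquiv (IsCMField.complexConj L) H' hc w hw g).val : GL (Fin 3) (w.1.adicCompletion L)) * T⁻¹ :=
    fun g => (congrArg (fun x : ↥(unitaryGroupOfForm (galAdicCompletionMap (L := L) (IsCMField.complexConj L) hw)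
        (placeForm (Matrix.of fun i j : Fin 3 => if i.val + j.val + 1 = 3 then (1 : L) else 0) w.1)) =>
          (x.val : GL (Fin 3) (w.1.adicCompletion L))) (ContinuousMulEquiv.trans_apply _ _ g)).trans
      (localNonsplitEquiv_localNonsplitCongr (IsCMField.complexConj L) hc w hw T isUnit_one h g)
  exact ⟨T, e, hT, hform, fun g => (hform g).symm ▸ mem_cmLocalIntegralLevel_iff_conj_mem_glInt L H' w hw hT g,
    fun γH b => (hform b).symm ▸ isLocalNormPair_iff_isConj_endoGL_conj L H' w hw T γH b⟩

end Frame

end Literature.NumberTheory.Rogawski1990
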